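import Literature.AlgebraicGeometry.Frobenioids.BaseSectionsOfObjectsCor57NonVacuity
import Literature.AlgebraicGeometry.Frobenioids.Cor411iiAssemblyFSM
import HarnessLib

/-!
# Frobenioids I, Corollary 5.7 (i)–(iv) PROVED at the arithmetic Frobenioids `C_{K/F}` — unconditionally

Mochizuki, *The geometry of Frobenioids I*, Kyushu J. Math. **62** (2008), Cor. 5.7 pp. 107–108, at the
arithmetic Frobenioids of Ex. 6.3 / Thm. 6.4 pp. 113–115 [cite: MochizukiFrdI2008, Cor. 5.7 p.107].

PROOF-ONLY companion (abc-iut-L1-d1 gen 3), sequel of `BaseSectionsOfObjectsCor57NonVacuity.lean` (p423793):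
there, Cor. 5.7 (i)–(iv) at an equivalence `Ψ : C_{K₁/F₁} ⥲ C_{K₂/F₂}` were obtained modulo ONE binder, the
typed [FrdI] Cor. 4.11 (ii) `PreFrobenioidData.Cor411ii` for `Ψ`. That binder is now a theorem over bases of
FSM-type with perf-factorial divisor monoids — abc-iut-L1-d6's `PreFrobenioid.cor411ii_ofFunctor_of_isOfFSMType`
(`Cor411iiAssemblyFSM.lean`) — and `D = FinSubextCat F K` is of FSM-type (abc-iut-L6-t10
`FinSubextCat.isOfFSMType`), `Φ` is perf-factorial (abc-iut-L1-d2). Hence: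

* `cor411ii_arith` — the typed Cor. 4.11 (ii) HOLDS for every `Ψ : C_{K₁/F₁} ⥲ C_{K₂/F₂}`;
* `exists_oneUniqueSquare_base_arith` — so `Ψ` induces a `1`-unique `Ψ^Base : D₁ ⥲ D₂` (the antecedent
  `Cor411Setting` being `cor411Setting_arith`): the `Ψ^Base` "induced by `Ψ`" of Thm. 6.4 (iv) p. 115;
* `cor57i_sections_arith'`, `cor57i_pairs_arith'`, `isOfPreModelType_iff_arith'`, `cor57ii_arith`,
  `cor57iii_arith'`, `cor57iv_arith'` — [FrdI] Cor. 5.7 (i)–(iv) at the arithmetic Frobenioids with NO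
  residual hypothesis ((iii)/(iv) SCHEMA in the birationalization data `B_i`, as typed).

No definitions, no named facts; nothing here bears on, or takes a side on, [IUTchIII] Cor. 3.12.
-/

noncomputable section

namespace Literature.AlgebraicGeometry.Frobenioids

open CategoryTheory Opposite
open PreFrobenioid

section Arith

variable {F₁ : Type} [Field F₁] [NumberField F₁] {K₁ : Type} [Field K₁] [Algebra F₁ K₁] [IsGalois F₁ K₁]
variable {F₂ : Type} [Field F₂] [NumberField F₂] {K₂ : Type} [Field K₂] [Algebra F₂ K₂] [IsGalois F₂ K₂]

/-- **[FrdI] Cor. 4.11 (ii) HOLDS for every equivalence `Ψ : C_{K₁/F₁} ⥲ C_{K₂/F₂}` of arithmetic Frobenioids**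
(the typed `PreFrobenioidData.Cor411ii`; abc-iut-L1-d6's FSM closer at `D_i = FinSubextCat F_i K_i` of
FSM-type, `Φ_i` perf-factorial, `C_i` Frobenioids). [cite: MochizukiFrdI2008, Cor. 4.11 (ii) p.91] -/
theorem cor411ii_arith (Ψ : arithFrobenioid F₁ K₁ ≌ arithFrobenioid F₂ K₂) :
    (arithFrobenioidOps F₁ K₁).Cor411ii (arithFrobenioidOps F₂ K₂) Ψ :=
  cor411ii_ofFunctor_of_isOfFSMType (arithFrobenioid_isFrobenioid F₁ K₁) (arithFrobenioid_isFrobenioid F₂ K₂)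
    Ψ (arith_objectwise_isPerfFactorial F₁ K₁) (arith_objectwise_isPerfFactorial F₂ K₂)
    (FinSubextCat.isOfFSMType F₁ K₁) (FinSubextCat.isOfFSMType F₂ K₂)

/-- **The `1`-unique `Ψ^Base : D₁ ⥲ D₂` induced by `Ψ`** (Cor. 4.11 (ii) p. 91; "the equivalence `D₁ ⥲ D₂`
induced by `Ψ`" of Thm. 6.4 (iv) p. 115): for every `Ψ : C_{K₁/F₁} ⥲ C_{K₂/F₂}` there is `Ψ^Base` with a
`1`-unique `1`-commutative square over the base functors — `cor411ii_arith` at `cor411Setting_arith`.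
[cite: MochizukiFrdI2008, Thm. 6.4 (iv) p.115] -/
theorem exists_oneUniqueSquare_base_arith (Ψ : arithFrobenioid F₁ K₁ ≌ arithFrobenioid F₂ K₂) :
    ∃ ΨBase : FinSubextCat F₁ K₁ ⥤ FinSubextCat F₂ K₂,
      PreFrobenioidData.OneUniqueSquare Ψ.functor (arithFrobenioidOps F₁ K₁).base
        (arithFrobenioidOps F₂ K₂).base ΨBase := by
  obtain ⟨ΨBase, hsq, -⟩ := cor411ii_arith Ψ (cor411Setting_arith F₁ K₁ F₂ K₂ Ψ)
  exact ⟨ΨBase, hsq⟩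

/-- **Cor. 5.7 (i), base-sections — PROVED at `Ψ : C_{K₁/F₁} ⥲ C_{K₂/F₂}`** (p. 107–108).
[cite: MochizukiFrdI2008, Cor. 5.7 (i) p.107] -/
theorem cor57i_sections_arith' (Ψ : arithFrobenioid F₁ K₁ ≌ arithFrobenioid F₂ K₂) :
    ∀ P₁ : Presection (arithFrobenioid F₁ K₁),
      IsBaseSection (ModelFrobenioid.toElem (arithDivisorFunctor F₁ K₁) (unitsFunctor F₁ K₁) (divNatTrans F₁ K₁))
        P₁ →
      ∃ P₂ : Presection (arithFrobenioid F₂ K₂),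
        IsBaseSection (ModelFrobenioid.toElem (arithDivisorFunctor F₂ K₂) (unitsFunctor F₂ K₂)
          (divNatTrans F₂ K₂)) P₂ ∧ MapsInto Ψ P₁ P₂ :=
  cor57i_sections_arith Ψ (cor411ii_arith Ψ)

/-- **Cor. 5.7 (i), quasi-base-Frobenius pairs — PROVED at `Ψ : C_{K₁/F₁} ⥲ C_{K₂/F₂}`** (p. 107–108).
[cite: MochizukiFrdI2008, Cor. 5.7 (i) p.107] -/
theorem cor57i_pairs_arith' (Ψ : arithFrobenioid F₁ K₁ ≌ arithFrobenioid F₂ K₂) :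
    ∀ (P₁ : Presection (arithFrobenioid F₁ K₁)) (Fr₁ : ℕ+ →* End P₁.ι),
      IsBaseFrobeniusPair
        (ModelFrobenioid.toElem (arithDivisorFunctor F₁ K₁) (unitsFunctor F₁ K₁) (divNatTrans F₁ K₁)) P₁ Fr₁ →
      ∃ (P₂ : Presection (arithFrobenioid F₂ K₂)) (Fr₂ : ℕ+ →* End P₂.ι) (τ : ℕ+ ≃* ℕ+)
        (h : MapsInto Ψ P₁ P₂),
        IsBaseFrobeniusPair
          (ModelFrobenioid.toElem (arithDivisorFunctor F₂ K₂) (unitsFunctor F₂ K₂) (divNatTrans F₂ K₂)) P₂ Fr₂ ∧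
          ∀ (n : ℕ+) (A : arithFrobenioid F₁ K₁) (hA : P₁.obj A),
            Ψ.functor.map ((Fr₁ n).app ⟨A, hA⟩) = (Fr₂ (τ n)).app ⟨Ψ.functor.obj A, h.1 A hA⟩ :=
  cor57i_pairs_arith Ψ (cor411ii_arith Ψ)

/-- **Cor. 5.7 (i), "`C₁` is of model type iff `C₂` is" (pre-model half) — PROVED at
`Ψ : C_{K₁/F₁} ⥲ C_{K₂/F₂}`** (p. 107). [cite: MochizukiFrdI2008, Cor. 5.7 (i) p.107] -/
theorem isOfPreModelType_iff_arith' (Ψ : arithFrobenioid F₁ K₁ ≌ arithFrobenioid F₂ K₂) :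
    IsOfPreModelType
        (ModelFrobenioid.toElem (arithDivisorFunctor F₁ K₁) (unitsFunctor F₁ K₁) (divNatTrans F₁ K₁)) ↔
      IsOfPreModelType
        (ModelFrobenioid.toElem (arithDivisorFunctor F₂ K₂) (unitsFunctor F₂ K₂) (divNatTrans F₂ K₂)) :=
  isOfPreModelType_iff_arith Ψ (cor411ii_arith Ψ) (cor411ii_arith Ψ.symm)

/-- **Cor. 5.7 (ii) — PROVED at `Ψ : C_{K₁/F₁} ⥲ C_{K₂/F₂}`** (p. 108): "`C₁` is of unit-profinite type if and
only if `C₂` is". [cite: MochizukiFrdI2008, Cor. 5.7 (ii) p.108] -/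
theorem cor57ii_arith (Ψ : arithFrobenioid F₁ K₁ ≌ arithFrobenioid F₂ K₂) :
    IsOfUnitProfiniteType
        (ModelFrobenioid.toElem (arithDivisorFunctor F₁ K₁) (unitsFunctor F₁ K₁) (divNatTrans F₁ K₁)) ↔
      IsOfUnitProfiniteType
        (ModelFrobenioid.toElem (arithDivisorFunctor F₂ K₂) (unitsFunctor F₂ K₂) (divNatTrans F₂ K₂)) :=
  cor57ii_arith_of_cor411ii Ψ (cor411ii_arith Ψ)

/-- **Cor. 5.7 (iii) — PROVED at `Ψ : C_{K₁/F₁} ⥲ C_{K₂/F₂}`** (p. 108; SCHEMA in the birationalization data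
`B_i`, as typed). [cite: MochizukiFrdI2008, Cor. 5.7 (iii) p.108] -/
theorem cor57iii_arith' (Ψ : arithFrobenioid F₁ K₁ ≌ arithFrobenioid F₂ K₂)
    (B₁ : (arithFrobenioidOps F₁ K₁).BiratData) (B₂ : (arithFrobenioidOps F₂ K₂).BiratData) :
    Cor57iii
      (ModelFrobenioid.toElem (arithDivisorFunctor F₁ K₁) (unitsFunctor F₁ K₁) (divNatTrans F₁ K₁))
      (ModelFrobenioid.toElem (arithDivisorFunctor F₂ K₂) (unitsFunctor F₂ K₂) (divNatTrans F₂ K₂)) Ψ B₁ B₂ :=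
  cor57iii_arith Ψ B₁ B₂ (cor411ii_arith Ψ)

/-- **Cor. 5.7 (iv) — PROVED at `Ψ : C_{K₁/F₁} ⥲ C_{K₂/F₂}`** (p. 108; SCHEMA in `B_i`, as typed).
[cite: MochizukiFrdI2008, Cor. 5.7 (iv) p.108] -/
theorem cor57iv_arith' (Ψ : arithFrobenioid F₁ K₁ ≌ arithFrobenioid F₂ K₂)
    (B₁ : (arithFrobenioidOps F₁ K₁).BiratData) (B₂ : (arithFrobenioidOps F₂ K₂).BiratData) :
    Cor57iv
      (ModelFrobenioid.toElem (arithDivisorFunctor F₁ K₁) (unitsFunctor F₁ K₁) (divNatTrans F₁ K₁))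
      (ModelFrobenioid.toElem (arithDivisorFunctor F₂ K₂) (unitsFunctor F₂ K₂) (divNatTrans F₂ K₂)) Ψ B₁ B₂ :=
  cor57iv_arith Ψ B₁ B₂ (cor411ii_arith Ψ)

end Arith

end Literature.AlgebraicGeometry.Frobenioids

end
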